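import Summits.ABC.ABC.Theses.DefiniteXi
import Summits.ABC.ABC.Theorems.EisensteinQuarantine.Negative.EisensteinQuarantineFalseOfProthDepthFamily
import Summits.ABC.ABC.Theorems.DefiniteXiEisensteinQuarantineThreeAdicCalibration
import Summits.ABC.ABC.Theorems.XiBound.Negative.XiBoundDomainSetup
import Summits.ABC.ABC.Theorems.DefiniteXiEisensteinQuarantineFreyEigenLinePrime
import Literature.NumberTheory.Sieve.PrimesInAPTwoPowerModuli
import HarnessLib

/-!
# Line `forced-pair-dlog` for crux `EisensteinQuarantine` (stmt-ABC-15023, route `DefiniteXi`)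
— crux-plan skeleton (NEGATION line: it closes the item `refuted`)

Crux (by name): `Summit.ABC.ABC.Theses.DefiniteXi.EisensteinQuarantine` — for every `ε > 0` a `C` with
`sixPart ξ := ordProj[2] ξ · ordProj[3] ξ ≤ C · N^ε · 𝓛` for every Frey curve `E_(a,b)`, every admissible
`N⁻ = Nm`, `ξ = brandtXi (N/Nm) Nm (a_n(E))`, `𝓛 = ∏_{q ∣ N, q ∤ Nm} ord_q Δ_min`.

State of the crux (crux NOTES / Lines/Sketch-dead.md / TRIAGE-r2-*): census-false AS FILED; the tree holds the
kernel-checked conditional kill `EisensteinQuarantine_false_of_ProthDepthFamily : ProthDepthFamily → ¬ crux`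
(p107816).  The only direction in which a line on this item can run is therefore the NEGATIVE one: construct
`H = ProthDepthFamily`.  This line does so from idea card `Ideas/forced-pair-dlog.md` (passed by both round-2
triagers):

* LEVER (2-adic discrete-log depth, forced).  In the abc triple `1 + (ℓ − 1) = ℓ` every odd prime `q ∣ ℓ − 1`
  has `ℓ ≡ 1 (mod q)`, so Mazur's invariant `log_q ℓ` vanishes to all depths; the level-`q` 2-Eisenstein tower
  (index `num((q−1)/12) ∋ 2^{v₂(q−1)−2}`), level-raised through the quarantined prime `ℓ` (`U_ℓ = a_ℓ(E) = +1`),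
  meets the Frey eigenvector `φ_E` of `E_(−ℓ, ℓ−1)` in the Brandt lattice of type `(N/ℓ, ℓ)` to 2-adic depth
  `v₂(q−1) − c`.  Choosing `q ≡ 1 (mod 2^s)` and `ℓ ≡ 1 (mod 2^s q)`, `ℓ ≤ 2^{As}` (two Linnik-type calls at
  2-power-times-prime moduli, stub 1) gives a polynomially sparse family with `2^s ≤ 2^c · ordProj[2] ξ`, i.e.
  `ProthDepthFamily`.
* WHY EASIER than the crux: a LOWER bound on a lattice congruence number is ONE explicit congruence
  `φ_E ≡ ψ (mod 2^m)` with `ψ ⊥_w φ_E` (landed dictionary p96490/p97646: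
  `Summit.ABC.ABC.Theorems.pow_le_ordProj_xi_of_occurrence`), on ONE explicit two-parameter family.

Registered stubs (all three genuine, independently provable, stated over tree declarations only).
RESHAPED by the line lead (a1, 2026-08-16) to the scope the composition actually consumes — rev 2:
* `stub_twoPowerPrimeSupply` (replaces the planner's `stub_linnikLeastPrimeOne`, Linnik for EVERY modulus, which
  the glue never needed and which requires the Deuring–Heilbronn phenomenon) — the TWO-PRIME 2-POWER SUPPLY: for
  all large `s` there are primes `q`, `ℓ` with `2^s ∣ q − 1`, `2^s q ∣ ℓ − 1`, `ℓ ≤ 2^{As}`.  Reachable from the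
  tree's UNCONDITIONAL Gallagher engine (`PrimesInAPGallagher.primesInAP_lowerBound` /
  `MontgomeryVaughan1975.gallagher_nonexceptional`, axioms standard) + Page (`exists_exceptionalZero_unique`) + "no
  primitive quadratic character of conductor `2^k`, `k ≥ 4`" (`PrimitiveQuadratic.level_two_pow_le_three`): the
  exceptional conductor at a 2-power modulus would be `4` or `8`, excluded for large level by `L(1, χ) ≠ 0`; an odd
  exceptional conductor kills at most one partner `q`, so two partners suffice.  PRIME SUPPLY.  Size L (lead).
* `stub_freyEigenLinePrime` (replaces `stub_freyEigenLineRankOne`, stated on the crux's whole domain incl. composite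
  `Nm` and `2^8 ∣ N`) — the Frey eigen-line is a LINE `ℤ φ` in every Brandt setup of type `(N/ℓ, ℓ)`, `ℓ` a PRIME
  of the SQUAREFREE conductor `N` (the only case the glue uses: `N = rad(ℓ(ℓ−1))`).  In this scope it is exactly
  the tree's named facts `Literature.NumberTheory.EllipticCurves.takahashi2001_brandtEigenLattice_rank_one`
  (Jacquet–Langlands / Eichler + strong multiplicity one, `finrank = 1`) + modularity of `E_(a,b)`
  (`nonempty_modularParametrizationData`) + `finrank 1 ⟹ ℤ φ` (30 lines).  Formal debt, precisely named.  Size XL.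
* `stub_forcedPairOccurrence` — THE MECHANISM (research stub, hardest; unchanged): on the forced family, for every
  setup and every generator `φ` of the Frey eigen-line there is `ψ ⊥_w φ` with `φ ≡ ψ (mod 2^{v₂(q−1) − c})`.
Glue (sorry-free, this file): `forcedPairDepthLaw_of_occurrence` (eigen-line + occurrence + landed
`pow_le_ordProj_xi_of_occurrence` + setup existence/independence ⟹ the card's `ForcedPairDepthLaw`),
`prothDepthFamily_of_forcedPairDepthLaw` (supply + law ⟹ `ProthDepthFamily`), the skeleton
theorem `ProthDepthFamily_of` concluding `Summit.ABC.ABC.Theorems.EisensteinQuarantine.Negative.ProthDepthFamily`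
BY NAME from the three stubs, and the line's end
`EisensteinQuarantine_refuted_of : ¬ Summit.ABC.ABC.Theses.DefiniteXi.EisensteinQuarantine` (via p107816).

STATE AFTER LEAD c2 (2026-08-17, cycle 2; stubs unchanged, skeleton re-registered f29f9316).  The line is at its floor:
* stub 2 `stub_freyEigenLinePrime` = named-fact debt, reduced (p132391) to `takahashi2001_brandtEigenLattice_rank_one`
  (Jacquet–Langlands/Eichler + strong multiplicity one, XL, nothing of it in Mathlib) + `FreyModularity` (route item);
* stub 3 `stub_forcedPairOccurrence` = research statement (no printed theorem at `p = 2`, squarefree level), dictionary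
  form p132787, unfalsifiable by finite census in its `∃ c` form, consistent with every computed row;
* negative lemmas landed: p133187 (`rank_one → FreyModularity → ForcedPairOccurrence → ¬EQ`) and the hypothesis-minimal
  valuation form `EisensteinQuarantine_false_of_ForcedPairDepthLaw : ForcedPairDepthLaw → ¬EQ` with the junk-sensitivity
  facts `isLine_of_forcedPairDepthLaw` / `frequently_isLine_of_forcedPairDepthLaw` (the law forces the eigen-line on an
  unbounded family, so EVERY refutation of this crux passes through the content of the rank-one fact) —
  `Theorems/EisensteinQuarantine/Negative/EisensteinQuarantineFalseOfForcedPairDepthLaw.lean` (p134266).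
Neither open stub is a stub-worker task; the lead hands stub 3 back as crux-sized (`promote-stub`) with the recommendation
that the planner of record file `ForcedPairDepthLaw` as a `@[conjecture]` bridge (the crux is census-false as filed and its
refutation is conjecture-conditional) and restate the crux (C″, Disproof.lean §4) for the route.

REV 4 (lead c5, 2026-08-17, after c3 `blocked-on`, c4 `line-dead` on both lines, and the planner's route-choice repair
b6fe27e7 of 01:33Z).  The eigen-line debt is now a route ITEM: stmt-ABC-17203 `DefiniteXi.BrandtEigenLatticeRankOne`
(crux r8, verbatim body of `takahashi2001_brandtEigenLattice_rank_one`, definitionally equal).  Rev-3 stub 2 is therefore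
RESHAPED into the two items it is the conjunction of — `stub_brandtEigenLatticeRankOne : BrandtEigenLatticeRankOne`
(= stmt-ABC-17203) and `stub_freyModularity : FreyModularity` (= stmt-ABC-11340) — and becomes the PROVED glue
`freyEigenLinePrime_of_items` (p132391 applied through the defeq).  Open stubs after rev 4: two route items (each with
its own crux chain; not worker tasks) and the research stub 3.  Composition unchanged:
`ProthDepthFamily_of = supply ∘ (items ⟹ eigen-line) ∘ occurrence`, `EisensteinQuarantine_refuted_of : ¬EQ`.
The line waits on stmt-ABC-17203 (necessary for every refutation, p136146) and on a proof source for stub 3.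

REV 5 (lead c6, 2026-08-17T03Z, seated by the route re-audit HONEST-BET after c5's `blocked-on: stmt-ABC-17203`).
Stubs and composition BYTE-IDENTICAL to rev 4 (re-verified on the farm: rc 0, 3 sorries = the 3 registered stubs, audit
`refutes` edge on the crux by name).  Audit of the stubs against the tree of 2026-08-17T03Z: stub 2a = item
stmt-ABC-17203 OPEN (unclaimed; grounded "known in print, vendored fact"); its Literature reduction advanced today to
`takahashi2001_brandtEigenLattice_rank_one_of_traceFormulas` (EichlerBasisTheoremOfTraceFormulas.lean: Eichler–Selberg
at levels `Mp`, `M` + Eichler's Brandt trace formula `hB`), with the global half of `hB` (Vignéras V Prop. 2.4) proved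
in `BrandtTraceOptimalEmbeddings.lean` — the dependency is live in its own chain; stub 2b = item stmt-ABC-11340 OPEN
(blocked-on `BCDT.CDT_theorem_7_1_2`); stub 3 unchanged (research; no proof source; Disproof.lean has no `-- Targets`
for this line).  No `_holds` discharge exists for either item.  Outcome of c6: `blocked-on: stmt-ABC-17203` (unchanged).

MECHANICAL NOTE for the lead.  `#h21_check_skeleton` only recognises a theorem whose conclusion head IS the crux
constant; a negation (`¬ crux`, head `Not`) is invisible to it.  Register this skeleton against the decl it
constructs: `ledger skeleton check <file> --crux stmt-ABC-15023
  --crux-decl Summit.ABC.ABC.Theorems.EisensteinQuarantine.Negative.ProthDepthFamily`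
(theorem `ProthDepthFamily_of`); the composition into `¬ crux` is `EisensteinQuarantine_refuted_of` below.
-/

-- `Summit.<Summit>.<Problem>`: for the single-conjunct summit `ABC` the duplicate `ABC.ABC` is mandated.
set_option linter.dupNamespace false

noncomputable section

namespace Summit.ABC.ABC.Cruxes.EisensteinQuarantine.ForcedPairDlog

open scoped BigOperators
open Literature.NumberTheory.Automorphic Literature.NumberTheory.EllipticCurves
open Summit.ABC.ABC.Theorems.EisensteinQuarantine.Negative

/-! ## Registered stubs -/

/-- **stub 1 — the two-prime 2-power supply (PRIME SUPPLY; Linnik-type, reachable from the tree; L).**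
There are `A, s₁` such that for every `s ≥ s₁` there are primes `q`, `ℓ` with `2^s ∣ q − 1`, `2^s q ∣ ℓ − 1`
and `ℓ ≤ 2^{As}`: the unquarantined forced partner `q` (so `v₂(q−1) ≥ s`, `q` odd) and the quarantined prime
`ℓ ≡ 1 (mod 2^s q)` of polynomial height.  This is what `prothDepthFamily_of_forcedPairDepthLaw` consumes — two
calls of Linnik's theorem for the class `1` at the moduli `2^s` and `2^s q` in print (Linnik 1944; Xylouris
2011 Thm 1.1) — and, unlike Linnik for a general modulus, it follows WITHOUT the Deuring–Heilbronn phenomenon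
from Gallagher's prime number theorem off one exceptional modulus (tree, proved:
`Literature.NumberTheory.Sieve.PrimesInAPGallagher.primesInAP_lowerBound`,
`Literature.NumberTheory.Sieve.MontgomeryVaughan1975.gallagher_nonexceptional`), Page's theorem (tree:
`exists_exceptionalZero_unique`: an exceptional zero belongs to a quadratic character) and the absence of
primitive quadratic characters of conductor `2^k`, `k ≥ 4` (tree: `PrimitiveQuadratic.level_two_pow_le_three`):
at a 2-power modulus the exceptional conductor could only be `4` or `8`, impossible for large level since
`L(1, χ) ≠ 0`; at the modulus `2^s q` an odd exceptional conductor disqualifies at most one partner `q`, and the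
first call supplies two.  STATUS: PROVED — `Literature/NumberTheory/Sieve/PrimesInAPTwoPowerModuli.lean`
(`exists_primes_two_pow_mul_dvd_sub_one`, p132885; shape lemma `primesInAP_lowerBound_shape`, p132474), so this
is no longer a stub but a reference. [cite: Gallagher1970, Theorem 7] -/
theorem stub_twoPowerPrimeSupply :
    ∃ A s₁ : ℕ, ∀ s : ℕ, s₁ ≤ s →
      ∃ q ℓ : ℕ, q.Prime ∧ ℓ.Prime ∧ 2 ^ s ∣ q - 1 ∧ 2 ^ s * q ∣ ℓ - 1 ∧ ℓ ≤ 2 ^ (A * s) :=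
  -- CLOSED (lead a1, cycle 1): the Literature theorem landed as p132885 (unconditional; p132474 for the shape lemma)
  Literature.NumberTheory.Sieve.PrimesInAPGallagher.exists_primes_two_pow_mul_dvd_sub_one

/-- **stub 2a — MULTIPLICITY ONE ON THE DEFINITE QUATERNION SIDE = route ITEM stmt-ABC-17203 verbatim
(`Summit.ABC.ABC.Theses.DefiniteXi.BrandtEigenLatticeRankOne`, crux r8, filed 2026-08-17 by the planner of record
precisely because this line — and, by p136146, EVERY refutation of the crux — needs it; XL: Eichler's basis
problem / Jacquet–Langlands + strong multiplicity one, reduced in tree to the Eichler–Pizer trace identity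
`takahashi2001_brandtEigenLattice_rank_one_of_traceIdentity`).**  For `W/ℚ` elliptic of squarefree conductor
`M·r`, `r` prime, with a modular parametrisation datum at level `M r`, and every Brandt setup of type `(M, r)`, the
`a(W)`-eigen-lattice of the Brandt matrices has `ℤ`-rank one.  Its body is definitionally the tree's named fact
`Literature.NumberTheory.EllipticCurves.takahashi2001_brandtEigenLattice_rank_one` (rev-3 stub 2 took that fact).
NOT a stub-worker task: it is an item with its own crux chain; it closes here by `BrandtEigenLatticeRankOne_holds`
the day the item closes. [cite: Takahashi2001, §2 p. 78] -/
theorem stub_brandtEigenLatticeRankOne : Summit.ABC.ABC.Theses.DefiniteXi.BrandtEigenLatticeRankOne := by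
  sorry

/-- **stub 2b — MODULARITY OF FREY CURVES IN DATUM FORM = route ITEM stmt-ABC-11340 verbatim
(`Summit.ABC.ABC.Theses.DefiniteXi.FreyModularity`, r9; Wiles 1995 / BCDT 2001 Thm A + Carayol; XL formal debt with
its own seats, `Theorems/DefiniteXiFreyModularity*.lean`; conditional discharge from the named fact
`nonempty_modularParametrizationData` landed as `freyModularity_of_nonempty_modularParametrizationData`).**  Every Frey
curve `E_(a,b)` (`a, b` coprime, `ab(a+b) ≠ 0`) carries a `ModularParametrizationData` at its conductor.  NOT a
stub-worker task. [cite: BCDTJAMS2001, Theorem A] -/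
theorem stub_freyModularity : Summit.ABC.ABC.Theses.DefiniteXi.FreyModularity := by
  sorry

/-- **Glue (PROVED; rev-3 stub 2 `stub_freyEigenLinePrime`) — the Frey eigen-line at a prime quarantine of a
squarefree conductor is a LINE, from the two route items.**  For `a, b` coprime with `ab(a+b) ≠ 0`, `N` the
SQUAREFREE conductor of `E_(a,b)`, a prime `ℓ ∣ N` and every Brandt setup `S` of type `(N/ℓ, ℓ)`, the common
eigen-lattice of the Brandt matrices for the eigenvalues `a_p(E)` is `ℤ ∙ φ`, `φ ≠ 0`.  Proof: the landed
`Summit.ABC.ABC.Theorems.freyEigenLinePrime_of_rankOne_of_freyModularity` (p132391) applied to stub 2a (whose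
statement is definitionally the named fact that theorem displays) and stub 2b.  Why the line needs it: off a line
`S.xi = 0` and `ordProj[2] 0 = 1`, so no LOWER bound on `ξ` holds without it. [cite: Takahashi2001, §2 p. 78] -/
theorem freyEigenLinePrime_of_items :
    ∀ a b : ℤ, IsCoprime a b → a * b * (a + b) ≠ 0 →
      ∀ (N : ℕ) [NeZero N], (freyCurve a b).conductorNorm ℤ = N → Squarefree N →
      ∀ ℓ : ℕ, ℓ.Prime → ℓ ∣ N →
      ∀ (S : Brandt.XiSetup (N / ℓ) ℓ) [Fintype (Brandt.ClassSet S.O)],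
        ∃ φ : Brandt.ClassSet S.O → ℤ, φ ≠ 0 ∧
          Brandt.eigenLattice (N / ℓ * ℓ) (Brandt.matrix S.O)
            (fun n => (freyCurve a b).LFunction n) = ℤ ∙ φ :=
  Summit.ABC.ABC.Theorems.freyEigenLinePrime_of_rankOne_of_freyModularity
    stub_brandtEigenLatticeRankOne stub_freyModularity

/-- **stub 3 — the FORCED-PAIR OCCURRENCE (THE MECHANISM; research stub, hardest; L/XL).**  There is `c`
such that for all primes `q ≠ 2` and `ℓ` with `32·q ∣ ℓ − 1` (so `ℓ ≡ 1 (mod q)`: the pair `(q, ℓ)` is FORCED,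
`log_q ℓ = 0` to all 2-adic depths), for the Frey curve `E = E_(−ℓ, ℓ−1)` of the triple `1 + (ℓ−1) = ℓ`
(Serre-normalised: `−ℓ ≡ −1 (mod 4)`, `32 ∣ ℓ − 1`; conductor `N = rad(ℓ(ℓ−1))`), every Brandt setup `S` of type
`(N/ℓ, ℓ)` (quarantine `N⁻ = ℓ`) and every generator `φ` of the `a(E)`-eigen-line: some `ψ` in the
`w`-orthogonal complement of `φ` (Gross weights `w_i = |O_iˣ|/2`) satisfies `φ ≡ ψ (mod 2^{v₂(q−1) − c})` — the
Frey system OCCURS modulo `2^{v₂(q−1)−c}` in the complement lattice.  Candidate witness (card): the level-`q`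
2-Eisenstein tower of Mazur (depth `v₂(num((q−1)/12)) = v₂(q−1) − 2`, so `c = 2` is the census-calibrated value)
raised through `ℓ` into the `ℓ`-new definite space — both roots of `X² − a_ℓ X + ℓ` are `≡ 1` to depth
`≥ min(v₂(ℓ−1), v₂ η_ℓ)` and `η_ℓ = a_ℓ − ℓ − 1` is deep BECAUSE `log_q ℓ = 0` (Mazur 1977 II.16.6/18.10;
Calegari–Emerton 2005 Prop 3.17(i); Lecouturier 2021 `(T_ℓ−ℓ−1)f_i = ((ℓ−1)/2)·log(ℓ)·f_{i−1}`; Ribet /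
Diamond–Taylor 1994 Thm 2 for the old/new fusion module in the definite algebra).  Census (kit j019358/j019359,
j019719): forced 2-prime odd levels `q = 17, 97, 193` ↦ rigorous `v₂ ξ ≥ 4, 7, 6 ≥ v₂(q−1) − 2`; first IN-SCOPE
instance `(q, ℓ) = (17, 5441)`: `v₂ ξ ≥ 13 ≥ 4`.  By the landed `pow_le_ordProj_xi_of_occurrence` this stub and
stub 2 give the card's `ForcedPairDepthLaw` (`forcedPairDepthLaw_of_occurrence` below). -/
theorem stub_forcedPairOccurrence :
    ∃ c : ℕ, ∀ q ℓ : ℕ, q.Prime → ℓ.Prime → q ≠ 2 → 32 * q ∣ ℓ - 1 →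
      ∀ N : ℕ, (freyCurve (-(ℓ : ℤ)) ((ℓ - 1 : ℕ) : ℤ)).conductorNorm ℤ = N →
      ∀ (S : Brandt.XiSetup (N / ℓ) ℓ) [Fintype (Brandt.ClassSet S.O)],
        ∀ φ : Brandt.ClassSet S.O → ℤ, φ ≠ 0 →
          Brandt.eigenLattice (N / ℓ * ℓ) (Brandt.matrix S.O)
              (fun n => (freyCurve (-(ℓ : ℤ)) ((ℓ - 1 : ℕ) : ℤ)).LFunction n) = ℤ ∙ φ →
          ∃ ψ : Brandt.ClassSet S.O → ℤ,
            ∑ i, (Brandt.weight S.O i : ℤ) * ψ i * φ i = 0 ∧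
              ∀ i, ((2 ^ ((q - 1).factorization 2 - c) : ℕ) : ℤ) ∣ φ i - ψ i := by
  sorry

/-! ## The reduction (sorry-free) -/

/-- **Rank one + forced-pair occurrence ⟹ the forced-pair depth law** (the card's `ForcedPairDepthLaw`, with
the same `c`): for primes `q ≠ 2`, `ℓ` with `32 q ∣ ℓ − 1` and `N` the conductor of `E_(−ℓ,ℓ−1)`,
`2^{v₂(q−1)} ≤ 2^c · ordProj[2] ξ(E; N/ℓ, ℓ)`.  Proof: the family lies in the crux's domain with `Nm = ℓ`
(`N = rad(ℓ(ℓ−1))` by the tree's Serre normalisation `conductorNorm_freyCurve_serre`, so `ℓ ∣ N`), hence a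
setup `S` exists (`nonempty_xiSetup_freyCurve`) and computes `ξ` (`Brandt.XiSetup.brandtXi_eq_xi`); stub 2 gives
the generator `φ`, stub 3 the witness `ψ`, and the landed `pow_le_ordProj_xi_of_occurrence` gives
`2^{v₂(q−1)−c} ≤ ordProj[2] ξ`. -/
theorem forcedPairDepthLaw_of_occurrence
    (hR : ∀ a b : ℤ, IsCoprime a b → a * b * (a + b) ≠ 0 →
      ∀ (N : ℕ) [NeZero N], (freyCurve a b).conductorNorm ℤ = N → Squarefree N →
      ∀ ℓ : ℕ, ℓ.Prime → ℓ ∣ N →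
      ∀ (S : Brandt.XiSetup (N / ℓ) ℓ) [Fintype (Brandt.ClassSet S.O)],
        ∃ φ : Brandt.ClassSet S.O → ℤ, φ ≠ 0 ∧
          Brandt.eigenLattice (N / ℓ * ℓ) (Brandt.matrix S.O)
            (fun n => (freyCurve a b).LFunction n) = ℤ ∙ φ)
    (hO : ∃ c : ℕ, ∀ q ℓ : ℕ, q.Prime → ℓ.Prime → q ≠ 2 → 32 * q ∣ ℓ - 1 →
      ∀ N : ℕ, (freyCurve (-(ℓ : ℤ)) ((ℓ - 1 : ℕ) : ℤ)).conductorNorm ℤ = N →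
      ∀ (S : Brandt.XiSetup (N / ℓ) ℓ) [Fintype (Brandt.ClassSet S.O)],
        ∀ φ : Brandt.ClassSet S.O → ℤ, φ ≠ 0 →
          Brandt.eigenLattice (N / ℓ * ℓ) (Brandt.matrix S.O)
              (fun n => (freyCurve (-(ℓ : ℤ)) ((ℓ - 1 : ℕ) : ℤ)).LFunction n) = ℤ ∙ φ →
          ∃ ψ : Brandt.ClassSet S.O → ℤ,
            ∑ i, (Brandt.weight S.O i : ℤ) * ψ i * φ i = 0 ∧
              ∀ i, ((2 ^ ((q - 1).factorization 2 - c) : ℕ) : ℤ) ∣ φ i - ψ i) :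
    ∃ c : ℕ, ∀ q ℓ : ℕ, q.Prime → ℓ.Prime → q ≠ 2 → 32 * q ∣ ℓ - 1 →
      ∀ N : ℕ, (freyCurve (-(ℓ : ℤ)) ((ℓ - 1 : ℕ) : ℤ)).conductorNorm ℤ = N →
        2 ^ ((q - 1).factorization 2) ≤
          2 ^ c * ordProj[2] (brandtXi (N / ℓ) ℓ
            (fun n => (freyCurve (-(ℓ : ℤ)) ((ℓ - 1 : ℕ) : ℤ)).LFunction n)) := by
  obtain ⟨c, hc⟩ := hO
  refine ⟨c, fun q ℓ hq hℓ hq2 h32 N hN => ?_⟩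
  -- the Frey data `(a, b) = (−ℓ, ℓ−1)` lie in the crux's domain with `Nm = ℓ`
  have hℓ1 : 1 ≤ ℓ := hℓ.one_lt.le
  have hM0 : ℓ - 1 ≠ 0 := by have := hℓ.two_le; omega
  have h32' : (32 : ℕ) ∣ ℓ - 1 := (Dvd.intro q rfl).trans h32
  have hℓ2 : ℓ ≠ 2 := by
    intro h
    rw [h] at h32'
    norm_num at h32'
  set a : ℤ := -(ℓ : ℤ) with ha
  set b : ℤ := ((ℓ - 1 : ℕ) : ℤ) with hb
  have hℓcast : (ℓ : ℤ) = ((ℓ - 1 : ℕ) : ℤ) + 1 := by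
    rw [Nat.cast_sub hℓ1]; push_cast; ring
  have hab_sum : a + b = -1 := by rw [ha, hb, hℓcast]; ring
  have habc : a * b * (a + b) = ((ℓ * (ℓ - 1) : ℕ) : ℤ) := by
    rw [hab_sum, ha, hb]; push_cast; ring
  have hPM0 : ℓ * (ℓ - 1) ≠ 0 := Nat.mul_ne_zero hℓ.ne_zero hM0
  have h0 : a * b * (a + b) ≠ 0 := by rw [habc]; exact_mod_cast hPM0
  have hab : IsCoprime a b := by
    rw [ha, hb, IsCoprime.neg_left_iff, Int.isCoprime_iff_gcd_eq_one, Int.gcd_natCast_natCast]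
    exact (Nat.coprime_self_sub_right hℓ1).mpr (Nat.coprime_one_right ℓ)
  have ha4 : a ≡ -1 [ZMOD 4] := by
    have h4M : (4 : ℕ) ∣ ℓ - 1 := (show (4 : ℕ) ∣ 32 by norm_num).trans h32'
    have h4 : (4 : ℤ) ∣ b := by rw [hb]; exact_mod_cast h4M
    have : a = -1 - b := by rw [ha, hb, hℓcast]; ring
    rw [this]
    calc -1 - b ≡ -1 - 0 [ZMOD 4] := Int.ModEq.sub_left _ ((Int.modEq_zero_iff_dvd).mpr h4)
      _ = -1 := by ring
  have hb32 : (32 : ℤ) ∣ b := by rw [hb]; exact_mod_cast h32'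
  have hnatAbs : (a * b * (a + b)).natAbs = ℓ * (ℓ - 1) := by rw [habc, Int.natAbs_natCast]
  haveI : (freyCurve a b).IsElliptic := isElliptic_freyCurve h0
  have hNval : N = UniqueFactorizationMonoid.radical (ℓ * (ℓ - 1)) := by
    rw [← hN, conductorNorm_freyCurve_serre hab h0 ha4 hb32, hnatAbs]
  have hNpos : 0 < N := by rw [hNval]; exact Nat.radical_pos _
  haveI : NeZero N := ⟨hNpos.ne'⟩
  have hNsq : Squarefree N := by rw [hNval]; exact UniqueFactorizationMonoid.squarefree_radical
  have hℓN : ℓ ∣ N := by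
    rw [hNval]
    refine Nat.dvd_of_mem_primeFactors ?_
    rw [Nat.primeFactors_radical, Nat.primeFactors_mul hℓ.ne_zero hM0, hℓ.primeFactors]
    simp
  have hodd : Odd ℓ := hℓ.odd_of_ne_two hℓ2
  have hcard : Odd ℓ.primeFactors.card := by rw [hℓ.primeFactors]; simp
  -- a Brandt setup of type `(N/ℓ, ℓ)` exists and computes `ξ`
  have hne := Summit.ABC.ABC.Theorems.XiBound.Negative.nonempty_xiSetup_freyCurve
    hab h0 hodd hℓ.squarefree hcard (by rw [hN]; exact hℓN)
  rw [hN] at hne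
  obtain ⟨S⟩ := hne
  letI : Fintype (Brandt.ClassSet S.O) := Fintype.ofFinite _
  rw [S.brandtXi_eq_xi]
  -- stub 2: the eigen-line; stub 3: the occurrence witness; landed dictionary: the depth
  obtain ⟨φ, hφ, hL⟩ := hR a b hab h0 N hN hNsq ℓ hℓ hℓN S
  obtain ⟨ψ, hψ, hcong⟩ := hc q ℓ hq hℓ hq2 h32 N hN S φ hφ hL
  have hle := Summit.ABC.ABC.Theorems.pow_le_ordProj_xi_of_occurrence Nat.prime_two S _ hφ hL
    ((q - 1).factorization 2 - c) hψ hcong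
  calc 2 ^ ((q - 1).factorization 2)
      ≤ 2 ^ (c + ((q - 1).factorization 2 - c)) := Nat.pow_le_pow_right (by norm_num) (by omega)
    _ = 2 ^ c * 2 ^ ((q - 1).factorization 2 - c) := pow_add _ _ _
    _ ≤ 2 ^ c * ordProj[2] (S.xi fun n => (freyCurve a b).LFunction n) := Nat.mul_le_mul_left _ hle

/-- **Two-prime supply + the forced-pair depth law ⟹ `ProthDepthFamily`** (the hypothesis `H` of the landed
`EisensteinQuarantine_false_of_ProthDepthFamily`, p107816), with the supply's own exponent `A`: given `s₀` put
`s := max s₀ (max s₁ 5)`; the supply gives primes `q`, `ℓ` with `2^s ∣ q − 1` (so `q ≠ 2`), `2^s q ∣ ℓ − 1`,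
`ℓ ≤ 2^{As}`; then `2^s ∣ ℓ − 1`, `32 q ∣ ℓ − 1`, and the law gives
`2^s ≤ 2^{v₂(q−1)} ≤ 2^c · ordProj[2] ξ(E_(−ℓ,ℓ−1); N/ℓ, ℓ)`. -/
theorem prothDepthFamily_of_forcedPairDepthLaw
    (hSup : ∃ A s₁ : ℕ, ∀ s : ℕ, s₁ ≤ s →
      ∃ q ℓ : ℕ, q.Prime ∧ ℓ.Prime ∧ 2 ^ s ∣ q - 1 ∧ 2 ^ s * q ∣ ℓ - 1 ∧ ℓ ≤ 2 ^ (A * s))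
    (hF : ∃ c : ℕ, ∀ q ℓ : ℕ, q.Prime → ℓ.Prime → q ≠ 2 → 32 * q ∣ ℓ - 1 →
      ∀ N : ℕ, (freyCurve (-(ℓ : ℤ)) ((ℓ - 1 : ℕ) : ℤ)).conductorNorm ℤ = N →
        2 ^ ((q - 1).factorization 2) ≤
          2 ^ c * ordProj[2] (brandtXi (N / ℓ) ℓ
            (fun n => (freyCurve (-(ℓ : ℤ)) ((ℓ - 1 : ℕ) : ℤ)).LFunction n))) :
    ProthDepthFamily := by
  obtain ⟨A, s₁, hAs⟩ := hSup
  obtain ⟨c, hc⟩ := hF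
  refine ⟨c, A, fun s₀ => ?_⟩
  set s : ℕ := max s₀ (max s₁ 5) with hs
  have hs5 : 5 ≤ s := (le_max_right _ _).trans (le_max_right _ _)
  have hs₁ : s₁ ≤ s := (le_max_left _ _).trans (le_max_right _ _)
  have h32s : (32 : ℕ) ∣ 2 ^ s := by
    rw [show (32 : ℕ) = 2 ^ 5 by norm_num]; exact Nat.pow_dvd_pow 2 hs5
  -- the unquarantined partner `q ≡ 1 (mod 2^s)` and the quarantined prime `ℓ ≡ 1 (mod 2^s q)`
  obtain ⟨q, ℓ, hq, hℓ, hsq, hsl, hℓA⟩ := hAs s hs₁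
  have hq2 : q ≠ 2 := by
    intro h
    rw [h] at hsq
    have := Nat.le_of_dvd (by norm_num) (h32s.trans hsq)
    omega
  have h2sl : 2 ^ s ∣ ℓ - 1 := (Dvd.intro q rfl).trans hsl
  have h32q : 32 * q ∣ ℓ - 1 := (Nat.mul_dvd_mul_right h32s q).trans hsl
  refine ⟨s, ℓ, le_max_left _ _, hℓ, h2sl, hℓA, fun N hN => ?_⟩
  -- depth: `2^s ≤ 2^{v₂(q−1)} ≤ 2^c · ordProj[2] ξ`
  have h := hc q ℓ hq hℓ hq2 h32q N hN
  have hqm1 : q - 1 ≠ 0 := by have := hq.two_le; omega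
  have hsv : s ≤ (q - 1).factorization 2 :=
    (Nat.prime_two.pow_dvd_iff_le_factorization hqm1).mp hsq
  exact (Nat.pow_le_pow_right (by norm_num) hsv).trans h

/-- **Skeleton theorem** — the line's composition target BY NAME: the three registered stubs construct
`H = ProthDepthFamily` (stub 2 + stub 3 ⟹ forced-pair depth law; + stub 1 ⟹ the polynomially sparse deep
family). -/
theorem ProthDepthFamily_of : Summit.ABC.ABC.Theorems.EisensteinQuarantine.Negative.ProthDepthFamily :=
  prothDepthFamily_of_forcedPairDepthLaw stub_twoPowerPrimeSupply
    (forcedPairDepthLaw_of_occurrence freyEigenLinePrime_of_items stub_forcedPairOccurrence)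

/-- **The line's end: the crux is refuted** — `¬ EisensteinQuarantine` from the three stubs through the landed
negative lemma `EisensteinQuarantine_false_of_ProthDepthFamily` (p107816).  When the stubs land, this theorem
(re-filed sorry-free under `Theorems/`) closes stmt-ABC-15023 as `refuted`. -/
theorem EisensteinQuarantine_refuted_of : ¬ Summit.ABC.ABC.Theses.DefiniteXi.EisensteinQuarantine :=
  EisensteinQuarantine_false_of_ProthDepthFamily ProthDepthFamily_of

end Summit.ABC.ABC.Cruxes.EisensteinQuarantine.ForcedPairDlog

end
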